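import Summits.NavierStokesRegularity.NavierStokesRegularity.Theorems.MustSqueeze.Negative.ConstantsKNSSMild

/-!
# Crux `ForcedSymmetry` (stmt-NavierStokesRegularity-4052), negative side: the far-past energy ledger
# needs the Oseen clause

Drefute g3 (line `time-anchor-bootstrap`).  The reduction of stub 2b `stub_futureVertexLiouvilleRotated`
to Pineau–Vicol Conj. 1.1 recorded in `Cruxes/ForcedSymmetry/NegativeNotes-stub_futureVertexLiouvilleRotated-g3.md`
starts from the far-past Leray-rate energy ledger (route item `FarPastLedger`, stmt-NavierStokesRegularity-14060:
`∀ C ∃ K ∀ u ∈ A_C ∀ t<0 ∀ x₀ ∀ R>0, ∫_{B_R(x₀)}‖u t x‖² ≤ K·R`).  This file kernel-checks that the ledger is a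
property of the GAUGE: with the class `IsTypeIAncientMild C u` (= H1 ∧ H2 ∧ H3 ∧ H4 C, the clauses of
`MustSqueeze/Negative/WithoutOseen.lean`) replaced by H1 ∧ H2 ∧ H4 C (the Oseen/KNSS-mild clause H3 dropped), the
ledger is FALSE — `farPastLedger_false_without_H3`.  Witness: the parasitic future-vertex soliton
`parasite t x = (1 − t)^{-1/2} e₀` (= `para` of `Negative/TimeAnchorStubs.lean`; smooth, divergence free, Type-I with
`C = 1`, not KNSS-mild), whose ball energies `∫_{B_R(x₀)}‖parasite t x‖² = |B_R|/(1−t)` grow like `R³`, not `R`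
(`setIntegral_norm_parasite_sq`).  So any proof of the ledger — and hence of the profile-decay upgrade behind stub 2b —
must use H3 (on paper it enters through the pressure representation `p = R_iR_j(u_iu_j)`, which is what excludes the
parasitic family; cf. Ideator1Notes §A.3 "Gauge check").  No statement of the route is asserted positively.
-/

noncomputable section

set_option linter.dupNamespace false

namespace Summit.NavierStokesRegularity.NavierStokesRegularity.Theorems.ForcedSymmetry.Negative.LedgerWithoutOseen

open MeasureTheory Set Metric Module
open Literature.Analysis.FluidPDE
open Summit.NavierStokesRegularity.NavierStokesRegularity.Theorems.MustSqueeze.Negative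

/-- `ℝ³`. -/
abbrev E3 : Type := EuclideanSpace ℝ (Fin 3)

/-- The parasitic future-vertex soliton `parasite t x = (1 − t)^{-1/2} e₀` (KNSS 2009 §1: `u = b(t)`,
`p = −b′(t)·x`).  It is the field `para` of `Negative/TimeAnchorStubs.lean` (p77637); it is re-declared here under its
own name only because the farm snapshot serving the gate had not yet built that module when this file was written —
a later seat may replace `parasite*` by the import. -/
def parasite (t : ℝ) (_x : E3) : E3 := (Real.sqrt (1 - t))⁻¹ • e0

/-- H1: `parasite` is smooth on the slab `t < 0`. -/
theorem parasite_h1 : H1 parasite := by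
  have h1 : ContDiffOn ℝ (⊤ : ℕ∞) (fun p : ℝ × E3 => (1 : ℝ) - p.1) (Iio 0 ×ˢ univ) :=
    (contDiff_const.sub contDiff_fst).contDiffOn
  have hne : ∀ p ∈ Iio (0 : ℝ) ×ˢ (univ : Set E3), (1 : ℝ) - p.1 ≠ 0 := by
    rintro ⟨t, x⟩ ⟨ht, -⟩
    simp only [mem_Iio] at ht
    show (1 : ℝ) - t ≠ 0
    linarith
  have h2 : ContDiffOn ℝ (⊤ : ℕ∞) (fun p : ℝ × E3 => Real.sqrt ((1 : ℝ) - p.1)) (Iio 0 ×ˢ univ) :=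
    h1.sqrt hne
  have hne2 : ∀ p ∈ Iio (0 : ℝ) ×ˢ (univ : Set E3), Real.sqrt ((1 : ℝ) - p.1) ≠ 0 := by
    rintro ⟨t, x⟩ ⟨ht, -⟩
    simp only [mem_Iio] at ht
    exact (Real.sqrt_pos.2 (by linarith)).ne'
  exact (h2.inv hne2).smul contDiffOn_const

/-- H2: `parasite` is divergence free (constant slices). -/
theorem parasite_h2 : H2 parasite := fun t ht =>
  (h1_h2_h6_const ((Real.sqrt (1 - t))⁻¹ • e0)).2.1 t ht

/-- `‖parasite t x‖ = 1/√(1 − t)` for `t < 1`. -/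
theorem norm_parasite (t : ℝ) (ht : t < 1) (x : E3) : ‖parasite t x‖ = (Real.sqrt (1 - t))⁻¹ := by
  rw [parasite, norm_smul, norm_inv, Real.norm_eq_abs, abs_of_pos (Real.sqrt_pos.2 (by linarith : (0:ℝ) < 1 - t))]
  simp [e0]

/-- H4 with `C = 1`: `‖parasite t x‖ = 1/√(1−t) ≤ 1/√(−t)` on `t < 0`. -/
theorem parasite_h4 : H4 1 parasite := by
  intro t ht x
  rw [norm_parasite t (by linarith) x, one_div]
  exact inv_anti₀ (Real.sqrt_pos.2 (by linarith)) (Real.sqrt_le_sqrt (by linarith))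

/-- The far-past Leray-rate energy ledger (verbatim the signature of route item `FarPastLedger`,
stmt-NavierStokesRegularity-14060) with the class `IsTypeIAncientMild C u` (= H1 ∧ H2 ∧ H3 ∧ H4 C) replaced by
H1 ∧ H2 ∧ H4 C: the Oseen clause dropped. -/
def FarPastLedgerWithoutH3 : Prop :=
  ∀ C : ℝ, ∃ K : ℝ, ∀ (u : ℝ → E3 → E3), H1 u → H2 u → H4 C u →
    ∀ t < 0, ∀ (x₀ : E3) (R : ℝ), 0 < R → ∫ x in ball x₀ R, ‖u t x‖ ^ 2 ≤ K * R

/-- Ball energies of the parasitic soliton: `∫_{B_R(x₀)} ‖parasite t x‖² = |B_R(x₀)| · (1 − t)⁻¹` (`t < 1`). -/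
theorem setIntegral_norm_parasite_sq (t : ℝ) (ht : t < 1) (x₀ : E3) (R : ℝ) :
    ∫ x in ball x₀ R, ‖parasite t x‖ ^ 2 = (volume (ball x₀ R)).toReal * (1 - t)⁻¹ := by
  have h : ∀ x : E3, ‖parasite t x‖ ^ 2 = (1 - t)⁻¹ := fun x => by
    rw [norm_parasite t ht x, inv_pow, Real.sq_sqrt (by linarith)]
  simp_rw [h]
  rw [setIntegral_const, smul_eq_mul, measureReal_def]

/-- The unit ball of `ℝ³` has positive finite volume (as a real number). -/
theorem volume_unitBall_toReal_pos : 0 < (volume (ball (0 : E3) 1)).toReal :=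
  ENNReal.toReal_pos (measure_ball_pos volume (0 : E3) one_pos).ne' measure_ball_lt_top.ne

/-- Volume scaling in `ℝ³`: `|B_R(x₀)| = R³ |B_1(0)|` for `R > 0`. -/
theorem volume_ball_toReal (x₀ : E3) {R : ℝ} (hR : 0 < R) :
    (volume (ball x₀ R)).toReal = R ^ 3 * (volume (ball (0 : E3) 1)).toReal := by
  rw [Measure.addHaar_ball_of_pos volume x₀ hR, finrank_euclideanSpace_fin, ENNReal.toReal_mul,
    ENNReal.toReal_ofReal (by positivity)]

/-- **The ledger needs H3.** `parasite` satisfies H1, H2 and H4 with `C = 1` (`Negative/TimeAnchorStubs`), but at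
`t = −1` its energy in `B_R(0)` is `R³|B_1|/2`, which exceeds `K·R` as soon as `R ≥ 1` and `R ≥ 2(|K|+1)/|B_1|`. -/
theorem farPastLedger_false_without_H3 : ¬ FarPastLedgerWithoutH3 := by
  intro h
  obtain ⟨K, hK⟩ := h 1
  set v : ℝ := (volume (ball (0 : E3) 1)).toReal with hv_def
  have hv : 0 < v := volume_unitBall_toReal_pos
  -- a radius that is `≥ 1` and `≥ 2(|K|+1)/v`
  set R : ℝ := max 1 (2 * (|K| + 1) / v) with hR_def
  have hR1 : 1 ≤ R := le_max_left _ _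
  have hRpos : 0 < R := lt_of_lt_of_le one_pos hR1
  have hR2 : 2 * (|K| + 1) / v ≤ R := le_max_right _ _
  have key := hK parasite parasite_h1 parasite_h2 parasite_h4 (-1) (by norm_num) 0 R hRpos
  rw [setIntegral_norm_parasite_sq (-1) (by norm_num) 0 R, volume_ball_toReal 0 hRpos] at key
  -- key : R ^ 3 * v * (1 - (-1))⁻¹ ≤ K * R
  have key' : R ^ 3 * v / 2 ≤ K * R := by
    have : (1 - (-1 : ℝ))⁻¹ = 1 / 2 := by norm_num
    rw [this] at key
    linarith
  -- from `hR2`: `v * R ≥ 2(|K|+1)`, hence `R³ v / 2 = (R²)(vR/2) ≥ R² (|K|+1) ≥ R (|K|+1) > K R`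
  have hvR : 2 * (|K| + 1) ≤ v * R := by
    have := (div_le_iff₀ hv).1 hR2
    linarith [this]
  have hRR : R ≤ R ^ 2 := by nlinarith
  have hKabs : K ≤ |K| := le_abs_self K
  have h1 : R * (|K| + 1) ≤ R ^ 3 * v / 2 := by
    have hsq : R ^ 2 * (|K| + 1) ≤ R ^ 3 * v / 2 := by
      have : R ^ 3 * v / 2 = R ^ 2 * (v * R / 2) := by ring
      rw [this]
      exact mul_le_mul_of_nonneg_left (by linarith) (by positivity)
    have hlin : R * (|K| + 1) ≤ R ^ 2 * (|K| + 1) :=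
      mul_le_mul_of_nonneg_right hRR (by positivity)
    exact hlin.trans hsq
  have h2 : K * R < R * (|K| + 1) := by nlinarith
  linarith

end Summit.NavierStokesRegularity.NavierStokesRegularity.Theorems.ForcedSymmetry.Negative.LedgerWithoutOseen

end
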